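import Summits.Ventures.DiscreteObjects.Hadamard.CyclicCorePAF
import Summits.Ventures.DiscreteObjects.Hadamard.Order334Nega

/-!
# H(668): an automorphism of order 334 yields a NEGAPERIODIC complementary pair of length 334 (kernel) — the order-334
# census line is the Ito / dicyclic family (negaperiodic Golay pairs of length 334)

Framing: lottery ticket; floor = certified bounds/negative ranges.

Cell pub-namedobj (venture DiscreteObjects), target (H), hadamard gen 19.  The EVEN companion of the cyclic-core dictionary
(`CyclicCorePAF`, orders 167 / 333 / 111 / primes).  Gen 12 (`Order334Orbits`, `Order334Nega`): a signed automorphism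
`(π, κ, d, e)` of a Hadamard matrix of order `668` whose permutation pair has order `334` acts with two regular orbits of length
`334` on rows and on columns, and every cycle sign product is `−1` (`cyc π d i 334 = −1 = cyc κ e j 334`): the automorphism is
NEGA-cyclic.  Here the sequences are extracted.  For a row `x₀` and a column `y` put, for `t ∈ ZMod 668`,
`ã_y(t) = (∏_{l<t} e (κ^l y)) · H x₀ (κ^t y)` — the row read along the SIGNED cycle of `y`; it is `±1`, has period `668` and is
ANTIperiodic of antiperiod `334` (`ã_y(t + 334) = −ã_y(t)`, the cycle product being `−1`).  The signed iteration
`H (π^r i) (κ^r j) = cyc_π(i,r) · cyc_κ(j,r) · H i j` gives, for `x₁ = π^(668−r) x₀`,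
`ã_y(t) ã_y(t + r) = cyc_π(x₁, r) · H x₀ (κ^t y) · H x₁ (κ^t y)` (all `κ`-signs cancel), so with a transversal `{y₁, y₂}` of the two
column orbits `PAF_{ã₁}(r) + PAF_{ã₂}(r) = 2 · cyc_π(x₁, r) · ⟨row x₀, row x₁⟩ = 0` whenever `r ∉ {0, 334}` (then `x₁ ≠ x₀`):
* **`negaPair_of_hadamard668_signedAut_334`**: pair order `334` ⇒ there are `±1` sequences `a, b : ZMod 668 → ℤ`, antiperiodic
  (`a (t + 334) = −a t`, `b (t + 334) = −b t`), with `PAF_a(s) + PAF_b(s) = 0` for every `s ∉ {0, 334}` — i.e. the length-`334`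
  halves form a NEGAPERIODIC COMPLEMENTARY (Golay) PAIR `NPAF_a + NPAF_b = 0`, equivalently two negacyclic `±1` matrices `A, B`
  of order `334` with `A Aᵀ + B Bᵀ = 668·I`; `negaPair_of_hadamard668_orderOf_334` is the `orderOf (π, κ) = 334` form.
By [Balonin–Đoković 2015 §9] (tree: `Literature.…ItoArray`) negaperiodic Golay pairs of length `2t = 334` are equivalent to
Ito-type (quasi-Williamson) Hadamard matrices of order `4t = 668`, i.e. to Ito's relative difference sets in the dicyclic group
of order `1336`: the order-334 census line IS PLAN-H's family F9 / F6 (and contains the Williamson family F1).  The converse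
(Ito-type ⇒ an automorphism of order 334) is not formalised here.  Dictionary / structure of a hypothetical object; no order
excluded; H(668) untouched.  Ours; no `sorry`, no definitions.
-/

namespace Summit.Ventures.DiscreteObjects.Hadamard

open Finset BigOperators Matrix

open Literature.Combinatorics.Designs.GoethalsSeidel (IsHadamardMatrix)
open Literature.Combinatorics.Designs.LegendrePairs (PAF IsPM)

variable {ι : Type*} [Fintype ι] [DecidableEq ι]

section negacycle
variable (κ : Equiv.Perm ι) (e : ι → ℤ)

omit [Fintype ι] [DecidableEq ι] in
/-- a nega-cycle of length `334` (sign product `−1` from every point): the partial products change sign after `334` steps -/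
lemma cyc_add_334_of_nega (hneg : ∀ j, cyc κ e j 334 = -1) (y : ι) (m : ℕ) :
    cyc κ e y (m + 334) = -cyc κ e y m := by
  rw [cyc_add, hneg]; ring

omit [Fintype ι] [DecidableEq ι] in
/-- … and are `668`-periodic -/
lemma cyc_add_668_mul_of_nega (hneg : ∀ j, cyc κ e j 334 = -1) (y : ι) (m : ℕ) :
    ∀ q, cyc κ e y (m + 668 * q) = cyc κ e y m := by
  intro q
  induction q with
  | zero => simp
  | succ q ih =>
    rw [show m + 668 * (q + 1) = (m + 668 * q + 334) + 334 by ring, cyc_add_334_of_nega κ e hneg,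
      cyc_add_334_of_nega κ e hneg, neg_neg, ih]

omit [Fintype ι] [DecidableEq ι] in
/-- so they only depend on the step count mod `668` -/
lemma cyc_mod_668_of_nega (hneg : ∀ j, cyc κ e j 334 = -1) (y : ι) (m : ℕ) :
    cyc κ e y (m % 668) = cyc κ e y m := by
  conv_rhs => rw [← Nat.mod_add_div m 668, cyc_add_668_mul_of_nega κ e hneg]

end negacycle

section order334
variable {H : Matrix ι ι ℤ} {π κ : Equiv.Perm ι} {d e : ι → ℤ}

omit [Fintype ι] [DecidableEq ι] in
/-- the signed partner row `x₁ = π^(668 − r) x₀` is moved back to `x₀` by `π^r`, and differs from `x₀` when `r ∉ {0, 334}` -/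
lemma order334_partner (hπ : π ^ 334 = 1) (hfree : ∀ i k, 0 < k → k < 334 → (π ^ k) i ≠ i) (x₀ : ι) {r : ℕ}
    (hr0 : 0 < r) (hr : r < 668) (hr334 : r ≠ 334) :
    (π ^ r) ((π ^ (668 - r)) x₀) = x₀ ∧ (π ^ (668 - r)) x₀ ≠ x₀ := by
  have h668 : π ^ 668 = 1 := by rw [show (668 : ℕ) = 334 * 2 by norm_num, pow_mul, hπ, one_pow]
  refine ⟨by rw [← Equiv.Perm.mul_apply, ← pow_add, show r + (668 - r) = 668 by omega, h668, Equiv.Perm.one_apply], ?_⟩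
  -- 668 - r = 334 q + r' with 0 < r' < 334
  have hmod : π ^ (668 - r) = π ^ ((668 - r) % 334) := (pow_mod_of_pow_eq_one π hπ (668 - r)).symm
  rw [hmod]
  refine hfree x₀ _ ?_ (Nat.mod_lt _ (by norm_num))
  rcases Nat.lt_or_ge r 334 with h | h
  · rw [show 668 - r = 334 + (334 - r) by omega, Nat.add_mod_left, Nat.mod_eq_of_lt (by omega)]; omega
  · rw [Nat.mod_eq_of_lt (by omega)]; omega

/-- **Order 334 ⇒ a negaperiodic complementary pair of length 334** (written on `ZMod 668` as two antiperiodic `±1` sequences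
whose periodic autocorrelations cancel off `{0, 334}`). -/
theorem negaPair_of_hadamard668_signedAut_334 (hH : IsHadamardMatrix H) (hι : Fintype.card ι = 668)
    (haut : IsSignedAut H π κ d e) (hπ : π ^ 334 = 1) (hκ : κ ^ 334 = 1) (h2 : π ^ 2 ≠ 1 ∨ κ ^ 2 ≠ 1)
    (h167 : π ^ 167 ≠ 1 ∨ κ ^ 167 ≠ 1) :
    ∃ a b : ZMod 668 → ℤ, IsPM a ∧ IsPM b ∧ (∀ t, a (t + 334) = -a t) ∧ (∀ t, b (t + 334) = -b t) ∧
      ∀ s : ZMod 668, s ≠ 0 → s ≠ 334 → PAF a s + PAF b s = 0 := by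
  obtain ⟨hfreeR, hfreeC⟩ := hadamard668_order334_free hH hι haut hπ hκ h2 h167
  obtain ⟨-, hnegC⟩ := hadamard668_order334_nega hH hι haut hπ hκ h2 h167
  have hκ668 : κ ^ 668 = 1 := by rw [show (668 : ℕ) = 334 * 2 by norm_num, pow_mul, hκ, one_pow]
  -- transversal of the two column orbits
  obtain ⟨T, -, hTcard, hT⟩ := exists_free_transversal κ (by norm_num : 0 < 334) _ (univ : Finset ι) le_rfl
    (fun y _ => Finset.mem_univ _) (fun y _ => by rw [hκ, Equiv.Perm.one_apply]) (fun y _ k hk0 hk => hfreeC y k hk0 hk)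
  rw [Finset.card_univ, hι] at hTcard
  have hT2 : T.card = 2 := by omega
  obtain ⟨x₀⟩ : Nonempty ι := Fintype.card_pos_iff.mp (by rw [hι]; norm_num)
  -- the signed cycle sequences
  let A : ι → ZMod 668 → ℤ := fun y t => cyc κ e y t.val * H x₀ ((κ ^ t.val) y)
  have hApm : ∀ y, IsPM (A y) := by
    intro y t
    rcases cyc_pm κ e haut.2.1 y t.val with h1 | h1 <;> rcases hH.1 x₀ ((κ ^ t.val) y) with h2 | h2 <;> simp [A, h1, h2]
  have hAanti : ∀ y t, A y (t + 334) = -A y t := by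
    intro y t
    simp only [A]
    rw [ZMod.val_add, cyc_mod_668_of_nega κ e hnegC y, pow_mod_of_pow_eq_one κ hκ668,
      show (334 : ZMod 668).val = 334 from rfl, cyc_add_334_of_nega κ e hnegC y, pow_add, hκ, mul_one]
    ring
  -- the autocorrelation of one signed cycle sequence
  have hPAF : ∀ y (s : ZMod 668), 0 < s.val → s.val ≠ 334 →
      PAF (A y) s = 2 * cyc π d ((π ^ (668 - s.val)) x₀) s.val *
        ∑ m ∈ Finset.range 334, H x₀ ((κ ^ m) y) * H ((π ^ (668 - s.val)) x₀) ((κ ^ m) y) := by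
    intro y s hs0 hs334
    set r := s.val with hr
    have hrlt : r < 668 := ZMod.val_lt s
    obtain ⟨hback, -⟩ := order334_partner hπ hfreeR x₀ hs0 hrlt hs334
    set x₁ := (π ^ (668 - r)) x₀ with hx₁
    -- pointwise identity
    have hpt : ∀ m : ℕ, cyc κ e y m * H x₀ ((κ ^ m) y) * (cyc κ e y (m + r) * H x₀ ((κ ^ (m + r)) y)) =
        cyc π d x₁ r * (H x₀ ((κ ^ m) y) * H x₁ ((κ ^ m) y)) := by
      intro m
      have hit : H x₀ ((κ ^ (m + r)) y) = cyc π d x₁ r * cyc κ e ((κ ^ m) y) r * H x₁ ((κ ^ m) y) := by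
        rw [← hback, add_comm, pow_add, Equiv.Perm.mul_apply]
        exact signedAut_pow haut r x₁ ((κ ^ m) y)
      have hca : cyc κ e y (m + r) = cyc κ e y m * cyc κ e ((κ ^ m) y) r := cyc_add κ e y m r
      rw [hit, hca]
      have h1 := pm_mul_self (cyc_pm κ e haut.2.1 y m)
      have h2 := pm_mul_self (cyc_pm κ e haut.2.1 ((κ ^ m) y) r)
      calc cyc κ e y m * H x₀ ((κ ^ m) y) *
            (cyc κ e y m * cyc κ e ((κ ^ m) y) r * (cyc π d x₁ r * cyc κ e ((κ ^ m) y) r * H x₁ ((κ ^ m) y)))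
          = (cyc κ e y m * cyc κ e y m) * (cyc κ e ((κ ^ m) y) r * cyc κ e ((κ ^ m) y) r) *
              (cyc π d x₁ r * (H x₀ ((κ ^ m) y) * H x₁ ((κ ^ m) y))) := by ring
        _ = cyc π d x₁ r * (H x₀ ((κ ^ m) y) * H x₁ ((κ ^ m) y)) := by rw [h1, h2]; ring
    -- PAF as a sum over range 668, then fold the two halves
    unfold PAF
    have hterm : ∀ t : ZMod 668, A y t * A y (t + s) =
        cyc κ e y t.val * H x₀ ((κ ^ t.val) y) * (cyc κ e y (t.val + r) * H x₀ ((κ ^ (t.val + r)) y)) := by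
      intro t
      simp only [A]
      rw [ZMod.val_add, cyc_mod_668_of_nega κ e hnegC y, pow_mod_of_pow_eq_one κ hκ668]
    simp only [hterm, hpt]
    rw [sum_zmod_val_eq_sum_range (fun m => cyc π d x₁ r * (H x₀ ((κ ^ m) y) * H x₁ ((κ ^ m) y))),
      ← Finset.mul_sum, show (668 : ℕ) = 334 + 334 by norm_num, Finset.sum_range_add]
    have hhalf : ∑ m ∈ Finset.range 334, H x₀ ((κ ^ (334 + m)) y) * H x₁ ((κ ^ (334 + m)) y) =
        ∑ m ∈ Finset.range 334, H x₀ ((κ ^ m) y) * H x₁ ((κ ^ m) y) := by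
      refine Finset.sum_congr rfl fun m _ => ?_
      rw [pow_add, hκ, one_mul]
    rw [hhalf]
    ring
  -- sum over the transversal: row orthogonality
  have hsum : ∀ s : ZMod 668, s ≠ 0 → s ≠ 334 → ∑ y ∈ T, PAF (A y) s = 0 := by
    intro s hs hs334
    have hs0 : 0 < s.val := (zmod_val_pos_of_ne_zero hs).1
    have hsv : s.val ≠ 334 := by
      intro h
      apply hs334
      have : ((s.val : ℕ) : ZMod 668) = ((334 : ℕ) : ZMod 668) := by rw [h]
      simpa using this
    obtain ⟨-, hne⟩ := order334_partner hπ hfreeR x₀ hs0 (ZMod.val_lt s) hsv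
    rw [Finset.sum_congr rfl fun y _ => hPAF y s hs0 hsv, ← Finset.mul_sum,
      ← hT (fun j => H x₀ j * H ((π ^ (668 - s.val)) x₀) j), hadamard_row_orth H hH (Ne.symm hne), mul_zero]
  -- name the two sequences
  let e2 : {y // y ∈ T} ≃ Fin 2 := Finset.equivFinOfCardEq hT2
  refine ⟨A (e2.symm 0), A (e2.symm 1), hApm _, hApm _, hAanti _, hAanti _, fun s hs hs334 => ?_⟩
  have h := hsum s hs hs334
  rw [← Finset.sum_coe_sort T] at h
  have hre : ∑ i : Fin 2, PAF (A (e2.symm i)) s = ∑ y : {y // y ∈ T}, PAF (A y) s :=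
    Fintype.sum_equiv e2.symm _ _ (fun _ => rfl)
  rw [← hre, Fin.sum_univ_two] at h
  simpa using h

/-- **Order form.**  `orderOf (π, κ) = 334` ⇒ a negaperiodic complementary pair of length `334` exists (as above). -/
theorem negaPair_of_hadamard668_orderOf_334 (hH : IsHadamardMatrix H) (hι : Fintype.card ι = 668)
    (π κ : Equiv.Perm ι) (d e : ι → ℤ) (haut : IsSignedAut H π κ d e)
    (hord : orderOf ((π, κ) : Equiv.Perm ι × Equiv.Perm ι) = 334) :
    ∃ a b : ZMod 668 → ℤ, IsPM a ∧ IsPM b ∧ (∀ t, a (t + 334) = -a t) ∧ (∀ t, b (t + 334) = -b t) ∧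
      ∀ s : ZMod 668, s ≠ 0 → s ≠ 334 → PAF a s + PAF b s = 0 := by
  obtain ⟨hπ, hκ, h2⟩ := pow_data_of_orderOf hord (a := 2) (by norm_num) (by norm_num)
  obtain ⟨-, -, h167⟩ := pow_data_of_orderOf hord (a := 167) (by norm_num) (by norm_num)
  exact negaPair_of_hadamard668_signedAut_334 hH hι haut hπ hκ h2 h167

end order334

end Summit.Ventures.DiscreteObjects.Hadamard
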